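import Summits.MatrixMultiplication.MatrixMultiplication.Theses.BrentRefutationDepth

/-!
# MatrixMultiplication / BrentRefutationDepth — support `SuperquadraticGap`
(stmt-MatrixMultiplication-5585)

Support (glue) item of the refutation line BrentRefutationDepth, exact route decl:

  `(∃ δ > 0, ∀ᶠ n in atTop, (n : ℝ) ^ (2 + δ) ≤ R(⟨n,n,n⟩)) → ¬ MatrixMultiplication`.

An eventual superquadratic lower bound for the tensor rank of `⟨n,n,n⟩` over `ℂ` forces every
admissible exponent `β` (`R(⟨n,n,n⟩) = O(n^β)`, Bläser 2013, Def. 5.1) to satisfy `2 + δ ≤ β`: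
otherwise `R(⟨n,n,n⟩) ≤ C·n^β` and `C < n^(2+δ-β)` for all large `n` (`n^(2+δ-β) → ∞` because
`2 + δ - β > 0`), and any large `n` gives
`n^(2+δ) ≤ R(⟨n,n,n⟩) ≤ C·n^β < n^(2+δ-β)·n^β = n^(2+δ)`, absurd.
Hence `ω(ℂ) = inf (admissible exponents) ≥ 2 + δ > 2` (`le_csInf`; the set is non-empty by
`admissibleExponents_nonempty`, the standard algorithm), which contradicts
`MatrixMultiplication ↔ ω(ℂ) = 2` (`MatrixMultiplication_iff`).

Companions already in the tree: the all-`n` glue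
`Literature.not_matrixMultiplication_of_superquadratic_rank` (`BorderRankLowerBoundAssembly`) and
the infinitely-often glue `add_le_omega_of_io_superquadratic`
(`PauliSmithLocalisationSuperquadraticInfinitelyOften`); this file is the `∀ᶠ`/`≤` form the route
BrentRefutationDepth states, proved directly (no import of other routes' files).

References: M. Bläser, *Fast Matrix Multiplication*, Theory of Computing Graduate Surveys 5
(2013), §5, Def. 5.1 (`ω = inf {β | R(⟨n,n,n⟩) = O(n^β)}`).
-/

noncomputable section

open Filter Asymptotics

namespace Summit.MatrixMultiplication.MatrixMultiplication.Theorems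

open Literature.Computability.AlgebraicComplexity

/-- If `n^(2+δ) ≤ R(⟨n,n,n⟩)` for all large `n` (tensor rank over `ℂ`), then every admissible
exponent `β` of matrix multiplication over `ℂ` (`R(⟨n,n,n⟩) = O(n^β)`, Bläser 2013, Def. 5.1)
satisfies `2 + δ ≤ β`: for `β < 2 + δ` the quotient `n^(2+δ-β)` tends to `∞` and eventually
exceeds the big-O constant. [folklore] -/
theorem add_le_of_mem_admissibleExponents_of_eventually_superquadratic {δ β : ℝ}
    (h : ∀ᶠ n : ℕ in atTop, (n : ℝ) ^ (2 + δ) ≤ (tensorRank (matMulTensor ℂ n n n) : ℝ))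
    (hβ : β ∈ admissibleExponents ℂ) : 2 + δ ≤ β := by
  by_contra hlt
  rw [not_le] at hlt
  obtain ⟨C, hC⟩ := hβ.bound
  have ht : Tendsto (fun n : ℕ => (n : ℝ) ^ (2 + δ - β)) atTop atTop :=
    (tendsto_rpow_atTop (by linarith)).comp tendsto_natCast_atTop_atTop
  obtain ⟨n, hle, h₁, h₂, h₃⟩ :=
    (h.and (hC.and ((ht.eventually_gt_atTop C).and (eventually_ge_atTop 1)))).exists
  have hpos : (0 : ℝ) < n := by exact_mod_cast h₃
  rw [Real.norm_of_nonneg (Nat.cast_nonneg _),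
    Real.norm_of_nonneg (Real.rpow_nonneg hpos.le _)] at h₁
  have key : (n : ℝ) ^ (2 + δ) ≤ C * (n : ℝ) ^ β := hle.trans h₁
  rw [show (2 + δ : ℝ) = (2 + δ - β) + β by ring, Real.rpow_add hpos] at key
  have key' : C * (n : ℝ) ^ β < (n : ℝ) ^ (2 + δ - β) * (n : ℝ) ^ β :=
    mul_lt_mul_of_pos_right h₂ (Real.rpow_pos_of_pos hpos _)
  exact lt_irrefl _ (key.trans_lt key')

/-- If `n^(2+δ) ≤ R(⟨n,n,n⟩)` for all large `n` (over `ℂ`), then `2 + δ ≤ ω(ℂ)`, where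
`ω(ℂ) = inf` of the admissible exponents (Bläser 2013, Def. 5.1; the set is non-empty by the
standard algorithm, `admissibleExponents_nonempty`). [folklore] -/
theorem add_le_omega_of_eventually_superquadratic {δ : ℝ}
    (h : ∀ᶠ n : ℕ in atTop, (n : ℝ) ^ (2 + δ) ≤ (tensorRank (matMulTensor ℂ n n n) : ℝ)) :
    2 + δ ≤ omega ℂ :=
  le_csInf (admissibleExponents_nonempty ℂ)
    fun _ hβ => add_le_of_mem_admissibleExponents_of_eventually_superquadratic h hβ

/-- **Support item `SuperquadraticGap` of route BrentRefutationDepth**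
(stmt-MatrixMultiplication-5585), exact route decl: an eventual superquadratic rank lower bound
`n^(2+δ) ≤ R(⟨n,n,n⟩)` for all large `n`, `δ > 0` fixed, contradicts `ω(ℂ) = 2`
(`MatrixMultiplication_iff`), because it forces `ω(ℂ) ≥ 2 + δ > 2`
(`add_le_omega_of_eventually_superquadratic`). [folklore] [cite: Blaser2013, Def. 5.1] -/
theorem superquadraticGap_proof :
    Summit.MatrixMultiplication.MatrixMultiplication.Theses.BrentRefutationDepth.SuperquadraticGap := by
  unfold Summit.MatrixMultiplication.MatrixMultiplication.Theses.BrentRefutationDepth.SuperquadraticGap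
  rintro ⟨δ, hδ, h⟩ hM
  rw [_root_.MatrixMultiplication_iff] at hM
  have h2 := add_le_omega_of_eventually_superquadratic h
  rw [hM] at h2
  linarith

end Summit.MatrixMultiplication.MatrixMultiplication.Theorems
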